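import Summits.BirchSwinnertonDyer.Rank1Residual.Supersingular.X8PrintClosers
import Summits.BirchSwinnertonDyer.Rank1Residual.GaloisImage.SupersingularExactImage
import Summits.BirchSwinnertonDyer.Rank1Residual.GaloisImage.SmallImageNiveauTwoSupersingular
import Summits.BirchSwinnertonDyer.Rank1Residual.Partition.IrreducibleOverQuadraticFieldSupersingular
import Literature.NumberTheory.EllipticCurves.Rank1Residual.X9NoEntry
import HarnessLib

/-!
# Leaf X8 (`p = 3` good supersingular, `a_3 = ±3`) — DISCHARGE INTERFACE §6: the SMALL-IMAGE
# sub-leaf X8 ∩ {`ρ̄_{E,3}` not onto} (crux `SharpFlatMainConjectureSmallImageX8`, item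
# stmt-BirchSwinnertonDyer-20402; census: 61 of 217 cells, label `3Nn`) — what the leaf predicate
# gives there BY NAME, and which printed image / level hypotheses FAIL there, as kernel theorems
# (cell `bsd-print-x8`, seat ty2 gen 1; sequel of `X8PrintDischarge.lean` §0–§3 / `X8PrintClosers.lean` §4–§5)

HONEST FRAMING (run/shared/lean/pub/bsd-print-x8/): THEOREMS ONLY — no definition, no named fact,
no `sorry`, nothing asserted about any curve, nothing booked; class X8 stays CONSTRUCTION-SHAPED and
the small-image crux 20402 stays OPEN. Every statement below is ONE OR TWO CALLS of theorems the
tree already has (cells `b2b-bsdres` O8 / N11, `bsd-ssimc` k3-c4 / k3-c5), cited by name; what those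
cells already proved AT THE X8 / X7 KEY is NOT restated here but listed in the table, and the one
missing link — the BRIDGE `ClassX8.classX7_of_not_surj` that makes every `ClassX7 ∧ ¬ Surj` theorem
of the `smallImage_*` family one call away on the 61 cells — is proved. The point of the file is the
TABLE: at an X8 pair with `¬ Surj W p` the referee and the provers find each printed hypothesis of the
theorems one might cite against crux 20402 either discharged or refuted, under one name.

## The table, §6 (X8 ∩ {¬ surj(3)}; `hX : ClassX8 W p`, `hns : ¬ Surj W p`, `hp2 := ClassX8.p_ne_two`)

STRUCTURE of the sub-leaf (§6a):
* the mod-`3` image is EXACTLY the normaliser of a non-split Cartan subgroup (order `16`, Sutherland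
  label `3Nn`): `ClassX8.imageEqNonsplitCartanNormalizer_of_not_surj` (here; Serre 1972 Prop. 12 +
  §2.2, tree `GaloisImage.hasModPImageEqNonsplitCartanNormalizer_of_goodSS_of_not_surj`); dichotomy
  `ClassX8.surj_or_imageEqNonsplitCartanNormalizer` (here: on X8 the labels `3Cs/3Cn/3B/3Ns` never
  occur); containment / `X_ns⁺(3)`-point form: `Theorems.smallImage_hasNonsplitCartanModPImage hp2
  (ClassX8.classX7_of_not_surj …) hns` (cell bsd-ssimc, CITED); order shape `8 ∣ #image`, `3 ∤ #image`:
  `Theorems.smallImage_card_image_shape` (CITED, via the bridge);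
* niveau 2 at `3` and `e_3 = 8`, on ALL of X8 (surjective or not): `E[3]|_{I_𝔓}` has NO stable line
  at any `𝔓 ∣ 3` — `ClassX8.not_exists_inertia_stableLine` (here; tree
  `GaloisImage.not_exists_inertia_stableLine_of_goodSS`) — and at the place's prime the inertia image
  is CYCLIC of order `8` — `ClassX8.exists_inertia_image_cyclic_card_eight` (here; Serre Prop. 12 as
  `isCyclic_and_card_inertia_map_of_dvd_frobeniusTrace`);
* (irred_𝒦) for EVERY quadratic field `K`, binder-free on ALL of X8 (no `Surj` datum; contrast
  `irrK_of_surj`): `ClassX8.irrK` (here; tree `irrK_of_goodSS`) — hypothesis (irred_𝒦) of JSW 2017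
  Thm. 3.3.1, "(iii) `ρ̄|_{G_K}` irreducible" of CCSS 2018 Thm. B, of Castella–Liu–Wan 2022 Thm. 8.2.1:
  the anticyclotomic road (prover p4) keeps this hypothesis on the 61 small-image cells;
* never semistable, hence inside corner X7: `Theorems.X8_smallImage_not_semistable` (cell bsd-ssimc,
  CITED); binder shape `¬ W.IsSemistable (𝓞 ℚ)` of `Sprung2024.cor12/cor13_…`:
  `ClassX8.not_isSemistable_of_not_surj` (here); the BRIDGE `ClassX8.classX7_of_not_surj` (here).

Printed hypotheses that FAIL on the whole sub-leaf (§6b; the integral Kato-side theorems are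
UNINSTANTIABLE there by theorem, not merely undischarged) — all but the first row CITED from cell
bsd-ssimc's `Theorems/SignedLowerHalvesSprungLowerHalfAtThreeSmallImage.lean` (X8 key) and
`Theorems/SignedLowerHalvesKobayashiMainConjectureSmallImageNoEngine.lean` (X7 key, via the bridge):
* Kato 2004 (12.5.2) "`SL₂(ℤ_p) ⊆ ρ(G_{ℚ(μ_{p^∞})})`" (Thm. 12.5 (4) / 17.4 (3); Perrin-Riou 2003
  Prop. 4.8; Kobayashi 2013 rem. after Cor. 1.4 — the `himg` binder of `ClassX8.perrinRiou2003_prop48_of_surj`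
  / `…kobayashi2013_rem13_of_surj`): on X8 it is EQUIVALENT to `surj(3)` — `ClassX8.imageContainsSL2_iff_surj`
  (here; Wuthrich 2014 Lemma 20 PROVED, `ClassX8.imageContainsSL2_of_surj`) — so FALSE on the sub-leaf:
  `Theorems.smallImage_not_imageContainsSL2 W p hns` (CITED);
* "`ρ_{E,p^∞} : G_ℚ → GL₂(ℤ_p)` surjective" (Sprung 2012 Thm. 7.16 integral clause = Thm. 1.4, the
  `hsurj` binder of `Sprung2012.thm716_sharpFlatCharIdeal_divisibility.integral`; Kato Thm. 17.4 (3)):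
  FALSE — `Theorems.smallImage_not_towerSurj W p hns` (CITED); only the RATIONAL clause `….rational`
  ("for some `n ≥ 0`, `pⁿ L^• ∈ Char X^•`", no image hypothesis) is instantiable;
* (im) "`SL₂(𝔽_p) ⊆` image" (BCS 2025; Kato 13.4 (3)): FALSE — `Theorems.smallImage_not_bigIm hp2
  (bridge) hns` (CITED);
* "`ρ̄_{E,p}` surjective" itself (Wuthrich 2014 Prop. 21 as typed, `ClassX8.wuthrich2014_prop21_of_surj`;
  Jetchev 2008 Thm. 1.1 / Kolyvagin "`ρ̄` onto" in p4's twist-certificate doors): absent by definition;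
  Wuthrich's Prop. 21 constant `C` is "divisible by … primes for which the Galois representation on
  `E[p]` is neither surjective nor contained in a Borel subgroup" (Doc. Math. 19 p. 400) — `3` is such
  a prime here (`hns`, `ClassX8.irr'`);
* (ram)/(mult) "a prime `ℓ ∥ N`, `ℓ ≠ p`, with `ρ̄` ramified at `ℓ` (`p ∤ ord_ℓ(Δ)`)" (Skinner 2016
  Thm. C (ii) (b); Skinner–Urban 2014 Thm. 2; Fouquet–Wan 2021 Thm. 5.1's `ℓ`; CCSS 2018 Thm. 5.8
  "ρ̄ ramified at the non-split `ℓ`"): FALSE — `Theorems.X8_smallImage_not_ram`,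
  `Theorems.X8_smallImage_not_fwLocus`, assembly `Theorems.X8_smallImage_no_engine` (CITED); the
  per-prime reading "at EVERY multiplicative `ℓ` of such a curve `3 ∣ ord_ℓ(Δ_min)`" is
  `ClassX8.dvd_ord_minimalDiscriminant_of_mult_of_not_surj` (here; ty3's census found a (ram) witness
  on 0 of the 61 cells — this is the reason);
* "semistable" / "square-free conductor" (Sprung 2024 Cor. 1.2/1.3; CCSS Thms. C/D; Wuthrich 2014
  Cor. 19 — "the hypothesis … that `E` is semi-stable can not be dropped … there are curves … such
  that `ρ_p` has its image in the normaliser of a non-split Cartan subgroup", p. 400; BSTW 2024 Thm.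
  1.3 and its twist clause: `Theorems.smallImage_not_semistable_twist`): FALSE (rows above).
What REMAINS instantiable on the sub-leaf (by name, no new content): Sprung 2012 Thm. 7.16 RATIONAL
clause; the image-free rank-0 road of Sprung 2024 §5.2 (`X8MainConjectureRoad.*`, p533869); BKO 2024
Cor. A.5 ♯/♭ (`BurungaleKobayashiOta2024.X8.bsdp_of_corA5_sharpFlat`, image-free given the ♯/♭ MC);
K1 (`SprungLowerDivisibilityAtThree`, item 19875); per-pair Heegner-index / descent certificates
(`HeegnerIndexRecordsNonSurjThreeX8*`, `NonsplitCartanThreeDescentRecordsX8Three*`). Hence, given K1,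
the open input on the 61 cells is exactly the `3`-power ambiguity `3ⁿ` of Thm. 7.16 — crux 20402 as
the planner typed it; no printed hypothesis set the tree knows is satisfiable there.

References: Serre 1972 [Serre1972] §1.11 Prop. 12, §2.2, §2.4 Prop. 15, §5.4 Prop. 21 i);
Kato 2004 [Kato2004Asterisque] (12.5.2), Thm. 12.5 (4); Wuthrich 2014 [Wuthrich2014] Lemma 20, Cor. 19,
Prop. 21 (pp. 399–400); Sprung 2012 [Sprung2012] Thm. 1.4 (p. 1486), Thm. 7.16 (p. 1504); Skinner 2016
[Skinner2016PacificMC] Thm. C (ii); Skinner–Urban 2014 [SkinnerUrban2014] Thm. 2; Furio–Lombardo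
[FurioLombardo2023] Thm. 1.5; JSW 2017 [JetchevSkinnerWan2017] Thm. 3.3.1 (irred_𝒦); Silverman
[SilvermanATAEC1994] V Ex. 5.13 (b); HOME/TY2-DISCHARGE-TABLE.md §E; `X8PrintDischarge.lean`;
`Theorems/SignedLowerHalvesSprungLowerHalfAtThreeSmallImage.lean`,
`Theorems/SignedLowerHalvesKobayashiMainConjectureSmallImageNoEngine.lean` (cell bsd-ssimc).
-/

noncomputable section

open scoped Classical NumberField

open Field IsDedekindDomain NumberField WeierstrassCurve Rat.HeightOneSpectrum
  Literature.NumberTheory.EllipticCurves Literature.NumberTheory.GaloisRepresentations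
  Literature.NumberTheory.EllipticCurves.Rank1Residual
  Literature.NumberTheory.EllipticCurves.Rank1Residual.Typed
  Literature.NumberTheory.SerreUniformity

namespace Summit.BirchSwinnertonDyer.Rank1Residual.Supersingular

variable (W : WeierstrassCurve ℚ) [W.IsElliptic] [W.IsGloballyMinimal] (p : ℕ) [Fact p.Prime]

/-! ### §6a. Structure of the small-image sub-leaf X8 ∩ {¬ surj(3)} -/

/-- **X8 ∧ `ρ̄_{E,3}` not onto ⟹ the mod-`3` image is EXACTLY the normaliser of a non-split Cartan
subgroup** (`3Nn`, order `16`): in some basis of `E[3]` and for some non-square `ε ∈ 𝔽₃` every `σ`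
acts through `C_ns⁺(ε)` and every element of `C_ns⁺(ε)` is some `σ`. One call of the tree's
`GaloisImage.hasModPImageEqNonsplitCartanNormalizer_of_goodSS_of_not_surj` (Serre Prop. 12: inertia at
`3` is a non-split Cartan `kˣ`; `kˣ ≤ G ≤ N(kˣ)`, `G ≠ kˣ` by complex conjugation, `(N : C) = 2`).
The CONTAINMENT form at the X7 key is cell bsd-ssimc's `Theorems.smallImage_hasNonsplitCartanModPImage`
(reach it through `ClassX8.classX7_of_not_surj`); equality is recorded here.
[cite: Serre1972, §1.11 Prop. 12 and §2.2] [cite: FurioLombardo2023, Thm. 1.5 (second alternative)] -/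
theorem ClassX8.imageEqNonsplitCartanNormalizer_of_not_surj (hX : ClassX8 W p) (hns : ¬ Surj W p) :
    HasModPImageEqNonsplitCartanNormalizer W p :=
  GaloisImage.hasModPImageEqNonsplitCartanNormalizer_of_goodSS_of_not_surj W p
    (ClassX8.p_ne_two W p hX) (ClassX8.goodSS W p hX) hns

/-- **Image dichotomy on X8: `ρ̄_{E,3}` is onto `GL₂(𝔽₃)` or its image is exactly `C_ns⁺(3)`** — the
labels `3Cs`, `3Cn`, `3B`, `3Ns` never occur on the leaf (census: 156 `surj` / 61 `3Nn` of 217).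
[cite: Serre1972, §1.11 Prop. 12 and §2.2] [cite: FurioLombardo2023, Thm. 1.5] -/
theorem ClassX8.surj_or_imageEqNonsplitCartanNormalizer (hX : ClassX8 W p) :
    Surj W p ∨ HasModPImageEqNonsplitCartanNormalizer W p :=
  GaloisImage.surj_or_hasModPImageEqNonsplitCartanNormalizer_of_goodSS W p
    (ClassX8.p_ne_two W p hX) (ClassX8.goodSS W p hX)

/-- **Niveau 2 on ALL of X8: at every prime `𝔓` of `ℤ̄` above `3`, `E[3]|_{I_𝔓}` has NO stable line**
(Serre Prop. 12, local form; tree `GaloisImage.not_exists_inertia_stableLine_of_goodSS`). In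
particular no "ordinary line", no canonical subgroup, no `I_3`-stable filtration of `E[3]` is available
to any argument on the leaf, surjective image or not. [cite: Serre1972, §1.11 Prop. 12] -/
theorem ClassX8.not_exists_inertia_stableLine (hX : ClassX8 W p)
    {v : HeightOneSpectrum (𝓞 ℚ)} (hv : ((p : ℕ) : 𝓞 ℚ) ∈ v.asIdeal)
    {𝔓 : Ideal (absIntegers (𝓞 ℚ) ℚ)} (h𝔓 : 𝔓 ∈ v.primesAbove) :
    ¬ ∃ L : AddSubgroup (geomTorsion W (p : ℤ)), Nat.card L = p ∧
      ∀ σ ∈ 𝔓.inertia (absoluteGaloisGroup ℚ), ∀ P ∈ L, σ • P ∈ L :=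
  GaloisImage.not_exists_inertia_stableLine_of_goodSS (ClassX8.p_ne_two W p hX)
    (ClassX8.goodSS W p hX) hv h𝔓

/-- **`e_3 = 8` on ALL of X8: at the place's prime `𝔓₀ ∣ 3` the inertia image `ρ̄_{E,3}(I_{𝔓₀})` is
CYCLIC of order `3² − 1 = 8`** (a non-split Cartan subgroup of `GL₂(𝔽₃)`; Serre Prop. 12 as it stands
in the tree, `isCyclic_and_card_inertia_map_of_dvd_frobeniusTrace` with the tame Kummer input
`exists_mem_inertia_smul_eq_mul_of_pow_eq`; the global shadow `8 ∣ #ρ̄(Γ_ℚ)` is cell bsd-ssimc's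
`Theorems.smallImage_sq_sub_one_dvd_card_image`). [cite: Serre1972, §1.11 Prop. 12 and §1.3 Props. 1–2] -/
theorem ClassX8.exists_inertia_image_cyclic_card_eight (hX : ClassX8 W p)
    {v : HeightOneSpectrum (𝓞 ℚ)} (hv : ((p : ℕ) : 𝓞 ℚ) ∈ v.asIdeal) :
    ∃ 𝔓 ∈ v.primesAbove,
      IsCyclic ((𝔓.inertia (absoluteGaloisGroup ℚ)).map (galoisRepTorsion W p)) ∧
        Nat.card ((𝔓.inertia (absoluteGaloisGroup ℚ)).map (galoisRepTorsion W p)) = 8 := by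
  have hp' : p.Prime := Fact.out
  have hp2 : p ≠ 2 := ClassX8.p_ne_two W p hX
  have hss : GoodSS W p := ClassX8.goodSS W p hX
  have h8 : p ^ 2 - 1 = 8 := by rw [hX.1]; norm_num
  have hveq : v = primesEquiv.symm ⟨p, hp'⟩ :=
    (natCast_mem_asIdeal_iff_eq_primesEquiv_symm v hp').mp hv
  have hvp : (primesEquiv v : ℕ) = p := by rw [hveq, Equiv.apply_symm_apply]
  obtain ⟨𝔓₀, hmem₀, h𝔓₀⟩ := exists_ideal_placeOver p hvp
  have hΔ : ¬ (p : ℤ) ∣ minimalDiscriminantInt W :=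
    W.not_dvd_minimalDiscriminantInt_of_hasGoodReductionAtPrime' p hss.1
  have hT : ∀ π ζ : AlgebraicClosure ℚ, π ^ (p ^ 2 - 1) = p → ζ ^ (p ^ 2 - 1) = 1 →
      ∃ s ∈ 𝔓₀.inertia (absoluteGaloisGroup ℚ), s • π = ζ * π := fun π ζ hπ hζ ↦
    exists_mem_inertia_smul_eq_mul_of_pow_eq p
      (Nat.sub_pos_of_lt (Nat.one_lt_pow two_ne_zero hp'.one_lt)) hvp h𝔓₀ hπ hζ
  obtain ⟨hcyc, hcard⟩ :=
    isCyclic_and_card_inertia_map_of_dvd_frobeniusTrace p hΔ hss.2 hp2 hmem₀ hT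
  exact ⟨𝔓₀, h𝔓₀, hcyc, hcard.trans h8⟩

/-- **(irred_𝒦) on ALL of X8, binder-free: for EVERY quadratic number field `K`, `E[3]` is an
irreducible `G_K`-module** — no `Surj` datum needed (contrast `irrK_of_surj`), so it serves the 61
small-image cells as well; one call of the tree's `irrK_of_goodSS` (Serre Prop. 12 with `τ²` in place
of `τ`: `8 ∤ 2·3·2`). This is hypothesis (irred_𝒦) of JSW 2017 Thm. 3.3.1, "(iii) `ρ̄|_{G_K}`
irreducible" of CCSS 2018 Thm. B, and of Castella–Liu–Wan 2022 Thm. 8.2.1 — the anticyclotomic road.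
[cite: Serre1972, §1.11 Prop. 12] [cite: JetchevSkinnerWan2017, Thm. 3.3.1 (hypothesis (irred_𝒦))] -/
theorem ClassX8.irrK (hX : ClassX8 W p) (K : Type) [Field K] [NumberField K]
    (h2 : Module.finrank ℚ K = 2) : (W.baseChange K).HasIrreducibleModPGaloisRep p :=
  irrK_of_goodSS W p (ClassX8.p_ne_two W p hX) (ClassX8.good W p hX)
    (ClassX8.dvd_frobeniusTrace W p hX) K h2

/-- **X8 ∧ `ρ̄_{E,3}` not onto ⟹ NOT semistable, in the binder shape `W.IsSemistable (𝓞 ℚ)` of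
`Sprung2024.cor12/cor13_…`** (contrapositive of Serre 1972 Prop. 21 i), `ClassX8.surj_of_semistable'`;
the `Semistable W` form is cell bsd-ssimc's `Theorems.X8_smallImage_not_semistable`, not restated). So
Sprung 2024 Cor. 1.2/1.3 ("square-free `N`"), CCSS 2018 Thms. C/D and Wuthrich 2014 Cor. 19 — whose
author notes (p. 400) that semistability "can not be dropped … normaliser of a non-split Cartan
subgroup" — are uninstantiable on the 61 cells. [cite: Serre1972, §5.4 Prop. 21 i)]
[cite: Wuthrich2014, Cor. 19 and the remark following it (p. 400)] -/
theorem ClassX8.not_isSemistable_of_not_surj (hX : ClassX8 W p) (hns : ¬ Surj W p) :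
    ¬ W.IsSemistable (𝓞 ℚ) :=
  fun h ↦ hns (ClassX8.surj_of_semistable' W p hX ((semistable_iff_isSemistable_ringOfIntegers W).mpr h))

/-- **BRIDGE: the small-image sub-leaf of X8 lies inside corner X7** (`GoodSS ∧ ¬ Semistable`). With
`ClassX8.p_ne_two`, every theorem of cell bsd-ssimc's `smallImage_*` family (key `p ≠ 2`, `ClassX7 W p`,
`¬ Surj W p`: `smallImage_no_engine`, `smallImage_not_bigIm`, `smallImage_card_image_shape`,
`smallImage_hasNonsplitCartanModPImage`, `smallImage_not_semistable_twist`, …) is ONE call away on the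
61 cells of crux 20402. [cite: Serre1972, §5.4 Prop. 21 i)] -/
theorem ClassX8.classX7_of_not_surj (hX : ClassX8 W p) (hns : ¬ Surj W p) : ClassX7 W p :=
  (ClassX8.classX7_iff_not_semistable W p hX).mpr
    fun hsst ↦ hns (ClassX8.surj_of_semistable' W p hX hsst)

/-! ### §6b. The printed image / level hypotheses that FAIL on X8 ∩ {¬ surj(3)} -/

/-- **On X8, Kato's (12.5.2) ⟺ `surj(3)`** (⟸: Wuthrich 2014 Lemma 20 at the good, hence semistable,
odd prime `3`, PROVED in the tree — `ClassX8.imageContainsSL2_of_surj`; ⟹: level `1` of (12.5.2),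
`Kato2004.hasSurjectiveModNGaloisRep_of_imageContainsSL2`). So ty3's census bit `surj3` DECIDES the
integrality hypothesis of every Kato-side theorem (Kato 12.5 (4) / 17.4 (3); Perrin-Riou 2003 Prop. 4.8;
Kobayashi 2013 rem. after Cor. 1.4 — the `himg` binder of `ClassX8.perrinRiou2003_prop48_of_surj` /
`…kobayashi2013_rem13_of_surj`), and it is `false` on exactly the 61 cells of crux 20402: there
(12.5.2) FAILS — `Theorems.smallImage_not_imageContainsSL2 W p hns` (cell bsd-ssimc, not restated) —
as does the `3`-adic tower surjectivity of Sprung 2012 Thm. 7.16's integral clause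
(`Theorems.smallImage_not_towerSurj`). [cite: Kato2004Asterisque, (12.5.2) in Thm. 12.5 (4) (p. 222)]
[cite: Wuthrich2014, Lemma 20 (p. 399)] -/
theorem ClassX8.imageContainsSL2_iff_surj (hX : ClassX8 W p) :
    Kato2004.ImageContainsSL2 W p ↔ Surj W p :=
  ⟨Kato2004.hasSurjectiveModNGaloisRep_of_imageContainsSL2 W p, ClassX8.imageContainsSL2_of_surj W p hX⟩

/-- **At EVERY prime `ℓ` of multiplicative reduction of a small-image X8 curve, `3 ∣ ord_ℓ(Δ_min)`**
(`E[3]` is unramified at every multiplicative prime; for split multiplicative `ℓ` this reads `3 ∣ c_ℓ`).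
A multiplicative `ℓ` with `3 ∤ ord_ℓ(Δ_min)` puts a transvection of order `3` in the image (Tate
curve), and with `E[3]` irreducible (`ClassX8.irr'`) that forces `ρ̄_{E,3}` onto (Serre Prop. 15; tree
`surj_of_irr_of_ram`); `ℓ ≠ 3` is automatic (`ClassX8.not_mult`). This is the per-prime reading of
(ram) FAILING on the sub-leaf — cell bsd-ssimc's `Theorems.X8_smallImage_not_ram` /
`X8_smallImage_not_fwLocus` / `X8_smallImage_no_engine` (not restated): hypothesis (b) of Skinner 2016
Thm. C (ii), (mult) of Skinner–Urban 2014 Thm. 2, the ramified `ℓ ∥ N` of Fouquet–Wan 2021 Thm. 5.1,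
"ρ̄ ramified at the non-split `ℓ`" of CCSS 2018 Thm. 5.8 are uninstantiable on the 61 cells (ty3's
census: a (ram) witness on 0 of them — this is why). [cite: Serre1972, §2.4 Prop. 15]
[cite: SilvermanATAEC1994, V.4–V.5 and Exercise 5.13 (b)] [cite: Skinner2016PacificMC, Thm. C (ii)]
[cite: SkinnerUrban2014, Thm. 2 (p. 3), second bullet] -/
theorem ClassX8.dvd_ord_minimalDiscriminant_of_mult_of_not_surj (hX : ClassX8 W p) (hns : ¬ Surj W p)
    (ℓ : ℕ) [Fact ℓ.Prime] (hmult : W.HasMultiplicativeReductionAtPrime ℓ) :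
    p ∣ padicValInt ℓ W.minimalDiscriminantInt := by
  by_contra hdiv
  have hℓp : ℓ ≠ p := by
    rintro rfl
    exact ClassX8.not_mult W ℓ hX hmult
  exact hns (surj_of_irr_of_ram W p (ClassX8.irr' W p hX) ⟨ℓ, inferInstance, hℓp, hmult, hdiv⟩)

end Summit.BirchSwinnertonDyer.Rank1Residual.Supersingular

end
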